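/-
COR-CM (cell pub-hodgecm2, stage 2 of the Hodge ladder) — Δ2 BRIDGE, WALL-BREAKER 4 («conjugate-side instantiation»), seat
`prover-pub-hodgecm2-d2bridge-wb-4-g0-0`, 2026-08-23.  ROUTE (Q) = CONJUGATE-CHARACTER INSTANTIATION of the pieces pin (d):
the rest's character is `ν` with `Φ_ν = Φ̄_{μ_i}` (e.g. `ν := μ_i^c`), the instance and Liu's `τ′` are the conjugate pin embedding
`ῑ₁ := conj ∘ ι₁` (where the tree's cofan ∕ J live, ✔ `AlbaneseOnPieceCofan` :181), S1 is run VERBATIM at `(ῑ₁, ν)`, and its records are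
admissible for the LITERAL dictionary key `adm i d := d.IsReflexOfTypeG ι₁ (typeOfLine (line i))` by the conjugation rule
`IsReflexOfTypeG ῑ₁ Φ ↔ IsReflexOfTypeG ι₁ Φ̄` (own-crow ∕ wb-2) and `Φ̄̄ = Φ`.  THEOREMS ONLY (kernel lane): no definition, no instance, no
named fact, no `sorry`.  FRAMING: HC_CM is NOT proved; «Δ2 BRIDGE CLOSED» is NOT claimed; whether the END should display [Liu21, Thm 4.18]
at the conjugate-character rests (the (a)-side price of this route) is the ASSEMBLER's ∕ referee's decision (branch (c-Ω) of the
orientation audit), not this file's.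
-/
import Summits.HodgeConjecture.CorCM.D2Bridge.HcmPiecesAtTowerLiu
import Summits.HodgeConjecture.CorCM.D2Bridge.HcmS1PinAdm
import Literature.NumberTheory.ComplexMultiplication.CMTypeBasic
import HarnessLib

set_option autoImplicit false

/-!
# Δ2 bridge, pin (d) at a DECOUPLED rest embedding `ιg` and for a CONJUGATE-TYPE character (route (Q))

* `nonempty_hcmPieces_ofTower_rest_of_cmDatum_at` — prove-8's ✔ `nonempty_hcmPieces_ofTower_rest_of_cmDatum` with the rest's
  presentation ∕ instance embedding `ιg : L →+* ℂ` DECOUPLED from the surface embedding `ι₁` of `V : HermSpace3 L ι₁` (S1 core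
  ✔ `exists_liuCMRecord_of_cmDatum ιg`); the admissibility input `hadm` is asked of the S1 record shape AT `ιg`.
* `isReflexOfTypeG_of_conj_of_bar` — the (Q)-specific admissibility transfer: a record admissible at `(ῑ₁, Φ̄)` is admissible at
  `(ι₁, Φ)`; the conjugation rule itself enters as the explicit binder `hconj` (= own-crow's `isReflexOfTypeG_starRingEnd_comp_iff`,
  desk file `OrientationReflexConj.lean` af529517a1ff63ab, to be imported when it lands; wb-2's `isReflexOfTypeG_conj_iff` is the same).
* `hadm_conjChar` — the `hadm` input of the first theorem at `ιg := ῑ₁`, character `ν` with `Φ_ν = Φ̄`, for ANY dictionary key `adm i`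
  implied by `IsReflexOfTypeG ι₁ Φ` (the literal pin: `Φ := typeOfLine (line i)`, implication `id`).
* `nonempty_hcmPieces_ofTower_rest_rekeyed` — route (P) ∕ the re-key (c-S.1): same `μ` presented at `ῑ₁`, key implied by
  `IsReflexOfTypeG ῑ₁ Φ_μ` (S1 verbatim at `ῑ₁`, ✔ `admLiu_mk_of_eq`).
* `nonempty_hcmPieces_ofTower_rest_conjChar` — THE PIECES BY VALUE for route (Q): (d) at the tower dictionary with key implied by
  `IsReflexOfTypeG ι₁ Φ`, rest `U.rest (restTailOne id ῑ₁ hν hwν Carν rhoΩ)`, instance `ῑ₁`, modulo the μ-generic J-side junction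
  inputs (`M Λ hMP jH rj hj α₀ hα₀ hα₀0 jf hrj`, prove-2 ∕ prove-3 ∕ prove-5) and `hconj`.

References: Y. Liu, arXiv:2102.11518 = Camb. J. Math. 9 (2021): Def. 4.3 (2), Rem. 4.4, Def. 4.5 (2), Def. 4.12, Thm. 4.18 (1) and
its proof l. 2246–2253; G. Shimura, *Abelian Varieties with CM* (1998) §8.3 Prop. 28.  HC_CM is NOT proved.
-/

noncomputable section

open scoped TensorProduct

namespace Summit.HodgeConjecture.CorCM.D2Bridge

open CategoryTheory NumberField
open Literature.AlgebraicGeometry.Motives (SchemeOver AbelianVariety bettiCohomology CMType)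
open Literature.AlgebraicGeometry.HodgeTheory
open Literature.AlgebraicGeometry.HodgeTheory.BettiUniverse (pull)
open Literature.AlgebraicGeometry.ShimuraVarieties.UnitaryCanonicalModel
open Literature.AlgebraicGeometry.ComplexMultiplication
open Literature.NumberTheory.ComplexMultiplication
open Literature.NumberTheory.Automorphic Literature.NumberTheory.Automorphic.PicardCM
open Literature.NumberTheory.Automorphic.IdeleClassGroup
open Literature.NumberTheory.Automorphic.Liu2021 Literature.NumberTheory.Automorphic.Liu2021.AppendixC
open Literature.NumberTheory.Automorphic.Liu2021.AppendixC.RestOne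
open Literature.NumberTheory.Transcendental (Arapura2012_Cor_15_4_6)
open HodgeCM.Model HodgeCM.Model.TowerCarrier
open HodgeCM.Literature.Theta.LiuAlbaneseModuleDatum.D2Bridge (HcmPieces)
open Literature.NumberTheory.ComplexMultiplication.CMTypeOps (bar mem_bar_iff)

/-! ## §1 Pin (d), S1 discharged, at a rest embedding `ιg` decoupled from the surface embedding `ι₁` -/

section Decoupled

variable {hHD : exists_isReal_hodgeModel} {hI : hodgePQ_independent_of_hodgeModel}
  {h₁ : BallQuotientUniformised} {h₃ : CMAbelianVarietyRealised} {hA : Arapura2012_Cor_15_4_6}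
variable {L : HodgeCM.CMField} [IsGalois ℚ (L : Type)] {ι₁ : (L : Type) →+* ℂ} (V : HodgeCM.HermSpace3 L ι₁)
variable (Char : Type) (Adm : Char → Type) (Ω : (i : Char) → Adm i → Type)
  [∀ i a, AddCommGroup (Ω i a)] [∀ i a, Module ℂ (Ω i a)] [∀ i a, Module (adelicAlgebra V) (Ω i a)]
  [∀ i a, IsScalarTower ℂ (adelicAlgebra V) (Ω i a)] (PhiMu : Char → Prop) (adm : Char → LiuCMSide → Prop)
variable (ιg : (L : Type) →+* ℂ)
  {μ : Literature.NumberTheory.Automorphic.IdeleClassGroup (L : Type) →ₜ* Circle}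
  (hμ : Literature.NumberTheory.Automorphic.IdeleClassGroup.IsConjugateSymplectic (L : Type) μ)
  (hw : Literature.NumberTheory.Automorphic.IdeleClassGroup.HasWeight (L : Type) μ 1) (Car : Def45.Carriers (L : Type) μ)


set_option maxHeartbeats 1600000 in
-- (one definitional re-typing `restOne … = U.rest (restTailOne …)` of the conclusion, as in prove-8's file; no search)
/-- **Pin (d) at the rests `U.rest (restTailOne id ιg …)`, S1 DISCHARGED, with the rest's embedding `ιg` DECOUPLED from `V`'s `ι₁`.**
As ✔ `nonempty_hcmPieces_ofTower_rest_of_cmDatum`, but the one-object rest is presented, and `A_μ` complexified, along an ARBITRARY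
`ιg : L →+* ℂ` (instance `ιg.toAlgebra`), while the tower, `res` and `cmClasses` stay those of `V : HermSpace3 L ι₁`; the S1 core
✔ `exists_liuCMRecord_of_cmDatum ιg` runs on the chosen Def. 4.5 (2) datum `datum id ιg … M.Dμ`, and `hadm` asks `adm i` of every model
CM record of Liu's reflex shape AT `ιg`.  At `ιg := ι₁` this is prove-8's theorem; at `ιg := ῑ₁` it is the pieces of route (Q) ∕ (P).
HC_CM is NOT proved; «Δ2 BRIDGE CLOSED» is NOT claimed.
[cite: Liu2021, Def. 4.5 (2) (FJcycle.tex l. 1944–1951), proof of Thm. 4.18 (l. 2246–2253), Thm. 4.18 (1), Rem. 4.17, Lem. 2.4 (1), Def. 4.11, Def. 4.16]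
[cite: Shimura1998, §7.1 Proposition 7 and §8.3 Prop. 28] -/
theorem nonempty_hcmPieces_ofTower_rest_of_cmDatum_at
    (h : exists_recordSystem) (Φ : Literature.AlgebraicGeometry.Motives.CMType L) {isotropicAt : ℕ → Prop}
    (C : Sec42Data (Model.honestP5Of h ⟨L.K⟩ ι₁ ⟨V.Hm, V.isHermitian, V.signature_ι₁, V.posDef_of_ne⟩ Φ) isotropicAt)
    (U : UniformOmega C)
    (rhoΩ : Representation (fieldOfValues (L : Type) μ) C.G (ΩOne C (AlgHom.id ℚ (L : Type)) ιg hμ hw Car))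
    (M : letI := ιg.toAlgebra
      (toThm418Data C (restOne C (AlgHom.id ℚ (L : Type)) ιg hμ hw Car U.Eps U.epsOf U.Chi (U.omega μ hμ) (U.rho μ hμ)
        rhoΩ)).Map43RationalData)
    (Λ : LevelwiseBettiPullback C (AμOne (AlgHom.id ℚ (L : Type)) ιg hμ hw Car M.Dμ) M.L M.U)
    (hMP : M.P = PΩOne C (AlgHom.id ℚ (L : Type)) ιg hμ hw Car M.Dμ Λ)
    (jH : M.HB →ₗ[ℂ] (LiuDictionary.ofTower hHD hI h₁ h₃ hA V Char Adm Ω PhiMu adm).H)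
    (i : Char) (K : HodgeCM.Level V)
    (rj : Λ.AKQ (C.levelOf K.K) →ₗ[ℚ]
      (picardCMUniverse hHD hI h₁ h₃).Coh ((picardCMUniverse hHD hI h₁ h₃).pms L ι₁ V K) 1)
    (hj : ∀ (z : ℂ) (x : Λ.AKQ (C.levelOf K.K)),
      resTotal hHD hI (ballQuotientUniformisedDatum_of h₁) h₃ hA K
          (jH (M.ι ((Λ.transKQ (C.levelOf K.K)).baseChange ℂ (z ⊗ₜ[ℚ] x)))) = z ⊗ₜ[ℚ] rj x)
    (α₀ : letI := ιg.toAlgebra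
      ℂ ⊗[ℚ] bettiCohomology ((AμOne (AlgHom.id ℚ (L : Type)) ιg hμ hw Car M.Dμ).baseChange ℂ).X 1)
    (hα₀ : letI := ιg.toAlgebra; haveI := hμ.numberField_muAlgValueField
      ∀ k : muAlgValueField (L : Type) μ,
        (hOneAlgHom ((AbelianVariety.endAlgebra.mapRingHom
            ((datum (AlgHom.id ℚ (L : Type)) ιg hμ hw Car M.Dμ).A.endBaseChange ℂ)).toRingHom.comp
          (datum (AlgHom.id ℚ (L : Type)) ιg hμ hw Car M.Dμ).i) k).baseChange ℂ α₀ =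
          ((k : muAlgValueField (L : Type) μ) : ℂ) • α₀)
    (hα₀0 : α₀ ≠ 0)
    (jf : letI := ιg.toAlgebra
      (C.A (C.levelOf K.K) ⟶ AμOne (AlgHom.id ℚ (L : Type)) ιg hμ hw Car M.Dμ) →
        ((pmsRealisation (ballQuotientUniformisedDatum_of h₁) (pmsCode L ι₁ V K)).X ⟶
          ((AμOne (AlgHom.id ℚ (L : Type)) ιg hμ hw Car M.Dμ).baseChange ℂ).X))
    (hrj : letI := ιg.toAlgebra
      ∀ f : C.A (C.levelOf K.K) ⟶ AμOne (AlgHom.id ℚ (L : Type)) ιg hμ hw Car M.Dμ,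
        (rj ∘ₗ Λ.phiStarQ (C.levelOf K.K) f).baseChange ℂ M.α = (pull (jf f) 1).baseChange ℂ α₀)
    (hadm : haveI := hμ.numberField_muAlgValueField
      ∀ (A : AbelianVariety ℂ) (ιA : NumberField.RingOfIntegers ↥(muAlgValueField (L : Type) μ) →+* End A)
        (θA : ↥(muAlgValueField (L : Type) μ) →+* Module.End ℂ (complexBetti A.X 1))
        (hA' : IsCMTypeRealisation (inducedCMType (Def45.incl (AlgHom.id ℚ (L : Type)) ιg hμ)
          (reflexCMType ιg hμ.cmType (AlgHom.id ℚ (L : Type)))) A ιA θA)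
        (α : ℂ ⊗[ℚ] bettiCohomology A.X 1)
        (hα : α ∈ eigenline (HodgeCM.CM.CommonReflex.complexify (BettiUniverse.cmAction θA hA'.isInducedOnIntegers))
          (muAlgValueField (L : Type) μ).subtype),
        adm i
          { K' := ↥(reflexField ℚ (L : Type) (algValuedIn ιg hμ.cmType.1))
            Φ' := (reflexCMType ιg hμ.cmType (AlgHom.id ℚ (L : Type))).1
            M := ↥(muAlgValueField (L : Type) μ)
            instNumberFieldM := hμ.numberField_muAlgValueField
            k := Def45.incl (AlgHom.id ℚ (L : Type)) ιg hμ
            A := A, ιA := ιA, θA := θA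
            ΦA := inducedCMType (Def45.incl (AlgHom.id ℚ (L : Type)) ιg hμ) (reflexCMType ιg hμ.cmType (AlgHom.id ℚ (L : Type)))
            hΦA := fun θ => mem_inducedCMType_iff _ _ θ
            isRealisation := hA'
            τ := (muAlgValueField (L : Type) μ).subtype
            α := α, α_mem := hα }) :
    letI := ιg.toAlgebra
    Nonempty (HcmPieces.{0, 1, 0}
      (toThm418Data C (U.rest (restTailOne (AlgHom.id ℚ (L : Type)) ιg hμ hw Car rhoΩ)))
      (M : (toThm418Data C (U.rest (restTailOne (AlgHom.id ℚ (L : Type)) ιg hμ hw Car rhoΩ))).Map43RationalData)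
      (LiuDictionary.ofTower hHD hI h₁ h₃ hA V Char Adm Ω PhiMu adm).H jH K.K
      ((picardCMUniverse hHD hI h₁ h₃).CohC ((picardCMUniverse hHD hI h₁ h₃).pms L ι₁ V K) 1)
      (resTotal hHD hI (ballQuotientUniformisedDatum_of h₁) h₃ hA K)
      ((LiuDictionary.ofTower hHD hI h₁ h₃ hA V Char Adm Ω PhiMu adm).cmClasses K i)) := by
  letI := ιg.toAlgebra
  haveI := hμ.numberField_muAlgValueField
  -- S1 core (prove-1, ✔ `exists_liuCMRecord_of_cmDatum`) AT `ιg`, on the chosen datum `datum … M.Dμ` (whose `A` IS `AμOne … M.Dμ`)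
  obtain ⟨B, uB, ιB, θB, hB, α', -, hα', hα'0, huB⟩ :=
    exists_liuCMRecord_of_cmDatum ιg (datum (AlgHom.id ℚ (L : Type)) ιg hμ hw Car M.Dμ) α₀ hα₀ hα₀0
  refine nonempty_hcmPieces_ofTower V Char Adm Ω PhiMu adm h Φ C (AlgHom.id ℚ (L : Type)) ιg hμ hw Car U.Eps U.epsOf U.Chi
    (U.omega μ hμ) (U.rho μ hμ) rhoΩ M Λ hMP jH i K rj hj α₀ jf hrj
    (fun q =>
      { K' := ↥(reflexField ℚ (L : Type) (algValuedIn ιg hμ.cmType.1))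
        Φ' := (reflexCMType ιg hμ.cmType (AlgHom.id ℚ (L : Type))).1
        M := ↥(muAlgValueField (L : Type) μ)
        instNumberFieldM := hμ.numberField_muAlgValueField
        k := Def45.incl (AlgHom.id ℚ (L : Type)) ιg hμ
        A := B, ιA := ιB, θA := θB
        ΦA := inducedCMType (Def45.incl (AlgHom.id ℚ (L : Type)) ιg hμ) (reflexCMType ιg hμ.cmType (AlgHom.id ℚ (L : Type)))
        hΦA := fun θ => mem_inducedCMType_iff _ _ θ
        isRealisation := hB
        τ := (muAlgValueField (L : Type) μ).subtype
        α := (q : ℂ) • α', α_mem := Submodule.smul_mem _ _ hα' })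
    (fun _ => uB.hom.hom.hom) (fun q Y f => ?_)
    (fun q => hadm B ιB θB hB ((q : ℂ) • α') (Submodule.smul_mem _ _ hα'))
  -- `hu`: `(f ≫ u)^*_ℂ (q • α') = q • f^*_ℂ α₀`
  show (pull (f ≫ uB.hom.hom.hom) 1).baseChange ℂ ((q : ℂ) • α') = (q : ℂ) • (pull f 1).baseChange ℂ α₀
  rw [LinearMap.map_smul]
  exact congrArg (fun v => (q : ℂ) • v) (huB Y f)

end Decoupled

/-! ## §2 The conjugate-character admissibility transfer (route (Q)): `(ῑ₁, Φ̄)`-admissible ⇒ `(ι₁, Φ)`-admissible -/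

section ConjChar

variable {L : HodgeCM.CMField} [IsGalois ℚ (L : Type)] (ι₁ : (L : Type) →+* ℂ)

omit [IsGalois ℚ (L : Type)] in
/-- `Φ̄̄ = Φ` for CM types (the conjugate type is the complement). [folklore] -/
theorem bar_bar_eq (Φ : CMType (L : Type)) : bar (bar Φ) = Φ :=
  Subtype.ext (compl_compl Φ.1)

omit [IsGalois ℚ (L : Type)] in
/-- **Route (Q)'s admissibility transfer.**  Under the conjugation rule `hconj` (`IsReflexOfTypeG ῑ₁ Ψ → IsReflexOfTypeG ι₁ Ψ̄` for every record
and type — own-crow's `isReflexOfTypeG_starRingEnd_comp_iff`, [Liu21] Rem. 4.4 ∕ Shimura Prop. 28), a record admissible at the conjugate pin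
`ῑ₁` for the CONJUGATE type `Φ̄` is admissible at `ι₁` for `Φ` — the dictionary's own key. [cite: Liu2021, Remark 4.4 (FJcycle.tex l. 1930–1933) and Def. 4.3 (2)] -/
theorem isReflexOfTypeG_of_conj_of_bar
    (hconj : ∀ (d : LiuCMSide) (Ψ : CMType (L : Type)),
      d.IsReflexOfTypeG ((starRingEnd ℂ).comp ι₁) Ψ → d.IsReflexOfTypeG ι₁ (bar Ψ))
    (Φ : CMType (L : Type)) (d : LiuCMSide) (hd : d.IsReflexOfTypeG ((starRingEnd ℂ).comp ι₁) (bar Φ)) :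
    d.IsReflexOfTypeG ι₁ Φ := by
  have h := hconj d (bar Φ) hd
  rwa [bar_bar_eq] at h

variable {ν : Literature.NumberTheory.Automorphic.IdeleClassGroup (L : Type) →ₜ* Circle}
  (hν : IsConjugateSymplectic (L : Type) ν)

/-- **`hadm` of §1 at `ιg := ῑ₁` for a character `ν` of CONJUGATE type `Φ_ν = Φ̄`, for any dictionary key `adm i` implied by
`IsReflexOfTypeG ι₁ Φ`.**  Every model CM record of Liu's reflex shape at `(ῑ₁, ν)` is `IsReflexOfTypeG ῑ₁ Φ_ν` (prove-1 ✔ `admLiu_mk` at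
`ῑ₁`), hence — `Φ_ν = Φ̄`, `hconj`, `Φ̄̄ = Φ` — `IsReflexOfTypeG ι₁ Φ`, hence `adm i`.  At the literal pin `Φ := typeOfLine (line i)` and
`hadmΦ := fun _ => id`.  (Hodge-type bookkeeping, for the referee: `ῑ₁ ∈ Φ_ν`, so these records' classes are of type (1,0), as are the
dictionary's — own-crow K2 read at `ῑ₁`; no (0,1)∕(1,0) clash on this route.)
[cite: Liu2021, Def. 4.3 (2) (FJcycle.tex l. 1919), Remark 4.4 (l. 1930–1933), Def. 4.5 (2) (l. 1944–1951)] [cite: Shimura1998, §8.3 Prop. 28] -/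
theorem hadm_conjChar
    (hconj : ∀ (d : LiuCMSide) (Ψ : CMType (L : Type)),
      d.IsReflexOfTypeG ((starRingEnd ℂ).comp ι₁) Ψ → d.IsReflexOfTypeG ι₁ (bar Ψ))
    (Φ : CMType (L : Type)) (hΦν : hν.cmType = bar Φ)
    (admi : LiuCMSide → Prop) (hadmΦ : ∀ d : LiuCMSide, d.IsReflexOfTypeG ι₁ Φ → admi d) :
    haveI := hν.numberField_muAlgValueField
    ∀ (A : AbelianVariety ℂ) (ιA : NumberField.RingOfIntegers ↥(muAlgValueField (L : Type) ν) →+* End A)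
      (θA : ↥(muAlgValueField (L : Type) ν) →+* Module.End ℂ (complexBetti A.X 1))
      (hA' : IsCMTypeRealisation (inducedCMType (Def45.incl (AlgHom.id ℚ (L : Type)) ((starRingEnd ℂ).comp ι₁) hν)
        (reflexCMType ((starRingEnd ℂ).comp ι₁) hν.cmType (AlgHom.id ℚ (L : Type)))) A ιA θA)
      (α : ℂ ⊗[ℚ] bettiCohomology A.X 1)
      (hα : α ∈ eigenline (HodgeCM.CM.CommonReflex.complexify (BettiUniverse.cmAction θA hA'.isInducedOnIntegers))
        (muAlgValueField (L : Type) ν).subtype),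
      admi
        { K' := ↥(reflexField ℚ (L : Type) (algValuedIn ((starRingEnd ℂ).comp ι₁) hν.cmType.1))
          Φ' := (reflexCMType ((starRingEnd ℂ).comp ι₁) hν.cmType (AlgHom.id ℚ (L : Type))).1
          M := ↥(muAlgValueField (L : Type) ν)
          instNumberFieldM := hν.numberField_muAlgValueField
          k := Def45.incl (AlgHom.id ℚ (L : Type)) ((starRingEnd ℂ).comp ι₁) hν
          A := A, ιA := ιA, θA := θA
          ΦA := inducedCMType (Def45.incl (AlgHom.id ℚ (L : Type)) ((starRingEnd ℂ).comp ι₁) hν)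
            (reflexCMType ((starRingEnd ℂ).comp ι₁) hν.cmType (AlgHom.id ℚ (L : Type)))
          hΦA := fun θ => mem_inducedCMType_iff _ _ θ
          isRealisation := hA'
          τ := (muAlgValueField (L : Type) ν).subtype
          α := α, α_mem := hα } := by
  intro A ιA θA hA' α hα
  refine hadmΦ _ (isReflexOfTypeG_of_conj_of_bar ι₁ hconj Φ _ ?_)
  rw [← hΦν]
  exact admLiu_mk ((starRingEnd ℂ).comp ι₁) hν A ιA θA hA' α hα

end ConjChar

/-! ## §3 THE PIECES BY VALUE for route (Q): conjugate-character rest, instance `ῑ₁`, literal-type key -/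

section RouteQ

variable {hHD : exists_isReal_hodgeModel} {hI : hodgePQ_independent_of_hodgeModel}
  {h₁ : BallQuotientUniformised} {h₃ : CMAbelianVarietyRealised} {hA : Arapura2012_Cor_15_4_6}
variable {L : HodgeCM.CMField} [IsGalois ℚ (L : Type)] {ι₁ : (L : Type) →+* ℂ} (V : HodgeCM.HermSpace3 L ι₁)
variable (Char : Type) (Adm : Char → Type) (Ω : (i : Char) → Adm i → Type)
  [∀ i a, AddCommGroup (Ω i a)] [∀ i a, Module ℂ (Ω i a)] [∀ i a, Module (adelicAlgebra V) (Ω i a)]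
  [∀ i a, IsScalarTower ℂ (adelicAlgebra V) (Ω i a)] (PhiMu : Char → Prop) (adm : Char → LiuCMSide → Prop)
variable {ν : Literature.NumberTheory.Automorphic.IdeleClassGroup (L : Type) →ₜ* Circle}
  (hν : Literature.NumberTheory.Automorphic.IdeleClassGroup.IsConjugateSymplectic (L : Type) ν)
  (hwν : Literature.NumberTheory.Automorphic.IdeleClassGroup.HasWeight (L : Type) ν 1) (Carν : Def45.Carriers (L : Type) ν)


set_option maxHeartbeats 1600000 in
-- (§1 at `ιg := ῑ₁` with `hadm := hadm_conjChar …`; the definitional re-typing of §1's conclusion is inherited)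
/-- **ROUTE (Q): the pieces (d) BY VALUE at the conjugate-character rest, instance `ῑ₁`, for ANY dictionary key at line `i` implied by
`IsReflexOfTypeG ι₁ Ψ` where the rest's character `ν` has `Φ_ν = Ψ̄`** (literal pin: `Ψ := typeOfLine (line i)`, `ν := μ_i^c` by
✔ `IsConjugateSymplectic.cmType_galConj`).  Liu's «`τ′ ∈ Φ_μ`» of the proof of Thm. 4.18 is met HONESTLY here: the instance ∕ carrier
embedding is `ῑ₁ ∈ Φ_ν`.  Inputs: the μ-generic J-side junction binders of ✔ `nonempty_hcmPieces_ofTower` at `(ῑ₁, ν)` (`M Λ hMP jH rj hj α₀ hα₀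
hα₀0 jf hrj` — prove-2 ∕ prove-3 ∕ prove-5 values) and the conjugation rule `hconj` (own-crow ∕ wb-2).  PRICE, not paid here: the (a)∕(b)
displays of the pin theorem move to the rest `U.rest (restTailOne id ῑ₁ hν …)` (hLiu at `ν`; Ω-pin at `ν`).  HC_CM is NOT proved;
«Δ2 BRIDGE CLOSED» is NOT claimed.
[cite: Liu2021, proof of Thm. 4.18 (FJcycle.tex l. 2246–2253), Thm. 4.18 (1), Def. 4.5 (2), Remark 4.4, Def. 4.12] [cite: Shimura1998, §8.3 Prop. 28] -/
theorem nonempty_hcmPieces_ofTower_rest_conjChar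
    (h : exists_recordSystem) (Φ : Literature.AlgebraicGeometry.Motives.CMType L) {isotropicAt : ℕ → Prop}
    (C : Sec42Data (Model.honestP5Of h ⟨L.K⟩ ι₁ ⟨V.Hm, V.isHermitian, V.signature_ι₁, V.posDef_of_ne⟩ Φ) isotropicAt)
    (U : UniformOmega C)
    (hconj : ∀ (d : LiuCMSide) (Ψ : CMType (L : Type)),
      d.IsReflexOfTypeG ((starRingEnd ℂ).comp ι₁) Ψ → d.IsReflexOfTypeG ι₁ (bar Ψ))
    (i : Char) (Ψ : CMType (L : Type)) (hΨν : hν.cmType = bar Ψ)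
    (hadmΨ : ∀ d : LiuCMSide, d.IsReflexOfTypeG ι₁ Ψ → adm i d)
    (rhoΩ : Representation (fieldOfValues (L : Type) ν) C.G
      (ΩOne C (AlgHom.id ℚ (L : Type)) ((starRingEnd ℂ).comp ι₁) hν hwν Carν))
    (M : letI := ((starRingEnd ℂ).comp ι₁).toAlgebra
      (toThm418Data C (restOne C (AlgHom.id ℚ (L : Type)) ((starRingEnd ℂ).comp ι₁) hν hwν Carν U.Eps U.epsOf U.Chi
        (U.omega ν hν) (U.rho ν hν) rhoΩ)).Map43RationalData)
    (Λ : LevelwiseBettiPullback C (AμOne (AlgHom.id ℚ (L : Type)) ((starRingEnd ℂ).comp ι₁) hν hwν Carν M.Dμ) M.L M.U)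
    (hMP : M.P = PΩOne C (AlgHom.id ℚ (L : Type)) ((starRingEnd ℂ).comp ι₁) hν hwν Carν M.Dμ Λ)
    (jH : M.HB →ₗ[ℂ] (LiuDictionary.ofTower hHD hI h₁ h₃ hA V Char Adm Ω PhiMu adm).H)
    (K : HodgeCM.Level V)
    (rj : Λ.AKQ (C.levelOf K.K) →ₗ[ℚ]
      (picardCMUniverse hHD hI h₁ h₃).Coh ((picardCMUniverse hHD hI h₁ h₃).pms L ι₁ V K) 1)
    (hj : ∀ (z : ℂ) (x : Λ.AKQ (C.levelOf K.K)),
      resTotal hHD hI (ballQuotientUniformisedDatum_of h₁) h₃ hA K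
          (jH (M.ι ((Λ.transKQ (C.levelOf K.K)).baseChange ℂ (z ⊗ₜ[ℚ] x)))) = z ⊗ₜ[ℚ] rj x)
    (α₀ : letI := ((starRingEnd ℂ).comp ι₁).toAlgebra
      ℂ ⊗[ℚ] bettiCohomology ((AμOne (AlgHom.id ℚ (L : Type)) ((starRingEnd ℂ).comp ι₁) hν hwν Carν M.Dμ).baseChange ℂ).X 1)
    (hα₀ : letI := ((starRingEnd ℂ).comp ι₁).toAlgebra; haveI := hν.numberField_muAlgValueField
      ∀ k : muAlgValueField (L : Type) ν,
        (hOneAlgHom ((AbelianVariety.endAlgebra.mapRingHom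
            ((datum (AlgHom.id ℚ (L : Type)) ((starRingEnd ℂ).comp ι₁) hν hwν Carν M.Dμ).A.endBaseChange ℂ)).toRingHom.comp
          (datum (AlgHom.id ℚ (L : Type)) ((starRingEnd ℂ).comp ι₁) hν hwν Carν M.Dμ).i) k).baseChange ℂ α₀ =
          ((k : muAlgValueField (L : Type) ν) : ℂ) • α₀)
    (hα₀0 : α₀ ≠ 0)
    (jf : letI := ((starRingEnd ℂ).comp ι₁).toAlgebra
      (C.A (C.levelOf K.K) ⟶ AμOne (AlgHom.id ℚ (L : Type)) ((starRingEnd ℂ).comp ι₁) hν hwν Carν M.Dμ) →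
        ((pmsRealisation (ballQuotientUniformisedDatum_of h₁) (pmsCode L ι₁ V K)).X ⟶
          ((AμOne (AlgHom.id ℚ (L : Type)) ((starRingEnd ℂ).comp ι₁) hν hwν Carν M.Dμ).baseChange ℂ).X))
    (hrj : letI := ((starRingEnd ℂ).comp ι₁).toAlgebra
      ∀ f : C.A (C.levelOf K.K) ⟶ AμOne (AlgHom.id ℚ (L : Type)) ((starRingEnd ℂ).comp ι₁) hν hwν Carν M.Dμ,
        (rj ∘ₗ Λ.phiStarQ (C.levelOf K.K) f).baseChange ℂ M.α = (pull (jf f) 1).baseChange ℂ α₀) :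
    letI := ((starRingEnd ℂ).comp ι₁).toAlgebra
    Nonempty (HcmPieces.{0, 1, 0}
      (toThm418Data C (U.rest (restTailOne (AlgHom.id ℚ (L : Type)) ((starRingEnd ℂ).comp ι₁) hν hwν Carν rhoΩ)))
      (M : (toThm418Data C (U.rest (restTailOne (AlgHom.id ℚ (L : Type)) ((starRingEnd ℂ).comp ι₁) hν hwν Carν rhoΩ))).Map43RationalData)
      (LiuDictionary.ofTower hHD hI h₁ h₃ hA V Char Adm Ω PhiMu adm).H jH K.K
      ((picardCMUniverse hHD hI h₁ h₃).CohC ((picardCMUniverse hHD hI h₁ h₃).pms L ι₁ V K) 1)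
      (resTotal hHD hI (ballQuotientUniformisedDatum_of h₁) h₃ hA K)
      ((LiuDictionary.ofTower hHD hI h₁ h₃ hA V Char Adm Ω PhiMu adm).cmClasses K i)) :=
  nonempty_hcmPieces_ofTower_rest_of_cmDatum_at V Char Adm Ω PhiMu adm ((starRingEnd ℂ).comp ι₁) hν hwν Carν h Φ C U rhoΩ M Λ hMP
    jH i K rj hj α₀ hα₀ hα₀0 jf hrj (hadm_conjChar ι₁ hν hconj Ψ hΨν (adm i) hadmΨ)

end RouteQ

/-! ## §4 ROUTE (P) for comparison (wb-3 ∕ the re-key (c-S.1)): SAME character `μ`, instance `ῑ₁`, key RE-KEYED at `ῑ₁` -/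

section RouteP

variable {hHD : exists_isReal_hodgeModel} {hI : hodgePQ_independent_of_hodgeModel}
  {h₁ : BallQuotientUniformised} {h₃ : CMAbelianVarietyRealised} {hA : Arapura2012_Cor_15_4_6}
variable {L : HodgeCM.CMField} [IsGalois ℚ (L : Type)] {ι₁ : (L : Type) →+* ℂ} (V : HodgeCM.HermSpace3 L ι₁)
variable (Char : Type) (Adm : Char → Type) (Ω : (i : Char) → Adm i → Type)
  [∀ i a, AddCommGroup (Ω i a)] [∀ i a, Module ℂ (Ω i a)] [∀ i a, Module (adelicAlgebra V) (Ω i a)]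
  [∀ i a, IsScalarTower ℂ (adelicAlgebra V) (Ω i a)] (PhiMu : Char → Prop) (adm : Char → LiuCMSide → Prop)
variable {μ : Literature.NumberTheory.Automorphic.IdeleClassGroup (L : Type) →ₜ* Circle}
  (hμ : Literature.NumberTheory.Automorphic.IdeleClassGroup.IsConjugateSymplectic (L : Type) μ)
  (hw : Literature.NumberTheory.Automorphic.IdeleClassGroup.HasWeight (L : Type) μ 1) (Car : Def45.Carriers (L : Type) μ)


set_option maxHeartbeats 1600000 in
-- (§1 at `ιg := ῑ₁` with `hadm := admLiu_mk_of_eq ῑ₁ …`; definitional re-typing inherited)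
/-- **ROUTE (P) (wb-3's conjugate-presented tail ∕ the RE-KEYED dictionary of (c-S.1)): the pieces (d) BY VALUE for the SAME character `μ`
presented at `ῑ₁`, instance `ῑ₁`, for ANY key at line `i` implied by `IsReflexOfTypeG ῑ₁ Ψ` with `Φ_μ = Ψ`** (the re-keyed pin:
`adm′ i d := d.IsReflexOfTypeG ῑ₁ (typeOfLine (line i))`).  S1 VERBATIM at `ῑ₁` (✔ `admLiu_mk_of_eq` at `ῑ₁`); no conjugation rule needed.
HC_CM is NOT proved; «Δ2 BRIDGE CLOSED» is NOT claimed.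
[cite: Liu2021, proof of Thm. 4.18 (FJcycle.tex l. 2246–2253), Thm. 4.18 (1), Def. 4.5 (2), Def. 4.3 (2)] [cite: Shimura1998, §8.3 Prop. 28] -/
theorem nonempty_hcmPieces_ofTower_rest_rekeyed
    (h : exists_recordSystem) (Φ : Literature.AlgebraicGeometry.Motives.CMType L) {isotropicAt : ℕ → Prop}
    (C : Sec42Data (Model.honestP5Of h ⟨L.K⟩ ι₁ ⟨V.Hm, V.isHermitian, V.signature_ι₁, V.posDef_of_ne⟩ Φ) isotropicAt)
    (U : UniformOmega C)
    (i : Char) (Ψ : CMType (L : Type)) (hΨμ : hμ.cmType = Ψ)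
    (hadmΨ : ∀ d : LiuCMSide, d.IsReflexOfTypeG ((starRingEnd ℂ).comp ι₁) Ψ → adm i d)
    (rhoΩ : Representation (fieldOfValues (L : Type) μ) C.G
      (ΩOne C (AlgHom.id ℚ (L : Type)) ((starRingEnd ℂ).comp ι₁) hμ hw Car))
    (M : letI := ((starRingEnd ℂ).comp ι₁).toAlgebra
      (toThm418Data C (restOne C (AlgHom.id ℚ (L : Type)) ((starRingEnd ℂ).comp ι₁) hμ hw Car U.Eps U.epsOf U.Chi
        (U.omega μ hμ) (U.rho μ hμ) rhoΩ)).Map43RationalData)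
    (Λ : LevelwiseBettiPullback C (AμOne (AlgHom.id ℚ (L : Type)) ((starRingEnd ℂ).comp ι₁) hμ hw Car M.Dμ) M.L M.U)
    (hMP : M.P = PΩOne C (AlgHom.id ℚ (L : Type)) ((starRingEnd ℂ).comp ι₁) hμ hw Car M.Dμ Λ)
    (jH : M.HB →ₗ[ℂ] (LiuDictionary.ofTower hHD hI h₁ h₃ hA V Char Adm Ω PhiMu adm).H)
    (K : HodgeCM.Level V)
    (rj : Λ.AKQ (C.levelOf K.K) →ₗ[ℚ]
      (picardCMUniverse hHD hI h₁ h₃).Coh ((picardCMUniverse hHD hI h₁ h₃).pms L ι₁ V K) 1)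
    (hj : ∀ (z : ℂ) (x : Λ.AKQ (C.levelOf K.K)),
      resTotal hHD hI (ballQuotientUniformisedDatum_of h₁) h₃ hA K
          (jH (M.ι ((Λ.transKQ (C.levelOf K.K)).baseChange ℂ (z ⊗ₜ[ℚ] x)))) = z ⊗ₜ[ℚ] rj x)
    (α₀ : letI := ((starRingEnd ℂ).comp ι₁).toAlgebra
      ℂ ⊗[ℚ] bettiCohomology ((AμOne (AlgHom.id ℚ (L : Type)) ((starRingEnd ℂ).comp ι₁) hμ hw Car M.Dμ).baseChange ℂ).X 1)
    (hα₀ : letI := ((starRingEnd ℂ).comp ι₁).toAlgebra; haveI := hμ.numberField_muAlgValueField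
      ∀ k : muAlgValueField (L : Type) μ,
        (hOneAlgHom ((AbelianVariety.endAlgebra.mapRingHom
            ((datum (AlgHom.id ℚ (L : Type)) ((starRingEnd ℂ).comp ι₁) hμ hw Car M.Dμ).A.endBaseChange ℂ)).toRingHom.comp
          (datum (AlgHom.id ℚ (L : Type)) ((starRingEnd ℂ).comp ι₁) hμ hw Car M.Dμ).i) k).baseChange ℂ α₀ =
          ((k : muAlgValueField (L : Type) μ) : ℂ) • α₀)
    (hα₀0 : α₀ ≠ 0)
    (jf : letI := ((starRingEnd ℂ).comp ι₁).toAlgebra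
      (C.A (C.levelOf K.K) ⟶ AμOne (AlgHom.id ℚ (L : Type)) ((starRingEnd ℂ).comp ι₁) hμ hw Car M.Dμ) →
        ((pmsRealisation (ballQuotientUniformisedDatum_of h₁) (pmsCode L ι₁ V K)).X ⟶
          ((AμOne (AlgHom.id ℚ (L : Type)) ((starRingEnd ℂ).comp ι₁) hμ hw Car M.Dμ).baseChange ℂ).X))
    (hrj : letI := ((starRingEnd ℂ).comp ι₁).toAlgebra
      ∀ f : C.A (C.levelOf K.K) ⟶ AμOne (AlgHom.id ℚ (L : Type)) ((starRingEnd ℂ).comp ι₁) hμ hw Car M.Dμ,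
        (rj ∘ₗ Λ.phiStarQ (C.levelOf K.K) f).baseChange ℂ M.α = (pull (jf f) 1).baseChange ℂ α₀) :
    letI := ((starRingEnd ℂ).comp ι₁).toAlgebra
    Nonempty (HcmPieces.{0, 1, 0}
      (toThm418Data C (U.rest (restTailOne (AlgHom.id ℚ (L : Type)) ((starRingEnd ℂ).comp ι₁) hμ hw Car rhoΩ)))
      (M : (toThm418Data C (U.rest (restTailOne (AlgHom.id ℚ (L : Type)) ((starRingEnd ℂ).comp ι₁) hμ hw Car rhoΩ))).Map43RationalData)
      (LiuDictionary.ofTower hHD hI h₁ h₃ hA V Char Adm Ω PhiMu adm).H jH K.K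
      ((picardCMUniverse hHD hI h₁ h₃).CohC ((picardCMUniverse hHD hI h₁ h₃).pms L ι₁ V K) 1)
      (resTotal hHD hI (ballQuotientUniformisedDatum_of h₁) h₃ hA K)
      ((LiuDictionary.ofTower hHD hI h₁ h₃ hA V Char Adm Ω PhiMu adm).cmClasses K i)) :=
  nonempty_hcmPieces_ofTower_rest_of_cmDatum_at V Char Adm Ω PhiMu adm ((starRingEnd ℂ).comp ι₁) hμ hw Car h Φ C U rhoΩ M Λ hMP
    jH i K rj hj α₀ hα₀ hα₀0 jf hrj
    (fun A ιA θA hA' α hα => hadmΨ _ (admLiu_mk_of_eq ((starRingEnd ℂ).comp ι₁) hμ A ιA θA hA' α hα Ψ hΨμ))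

end RouteP

end Summit.HodgeConjecture.CorCM.D2Bridge

end
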